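/-
Copyright (c) 2026. Released under Apache 2.0 license.
-/
import Summits.RiemannHypothesis.RiemannHypothesis.Theorems.SemilocalCert554Check
import Summits.RiemannHypothesis.RiemannHypothesis.Theorems.SemilocalThresholdCertificateBridge
import Summits.RiemannHypothesis.RiemannHypothesis.Theorems.SemilocalNegCert055747
import HarnessLib

/-!
# Semi-local threshold `a*({2})`: the lower rung `277/500 = 0.554 ≤ a*({2})` (was `69/125 = 0.552`)

Cell `rh-explicit`, seat cc-s2-2, block C⁺/B2.  The kernel-checked one-prime Stage-C certificate `weilCert3S554`
(`weilCert3S554.check = true`, `SemilocalCert554Check.lean`; window `b = 277/500 ≤ 6931471/10⁷ ≤ log 2`) through the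
generic bridge (B+) of `SemilocalThresholdCertificateBridge.lean`
(`weilSemilocalPositivityOn_two_of_check_of_le`, `le_weilSemilocalThreshold`):
`{∞,2}`-positivity of the semi-local Weil form on `C(277/500)`, hence `277/500 ≤ a*({2})`
(`weilSemilocalThreshold {2}`, `MotivicDoorSemilocalThreshold.lean`), and the same for every finite `S ∋ 2`,
`3 ∉ S`.  With the tree's upper rung `a*({2}) ≤ 97/174` (`SemilocalNegCert055747.lean`) this reads
`a*({2}) ∈ [0.554, 0.557472]`, an interval of width `< 0.0035`; DATA `a*({2}) = 0.55729 ± 10⁻⁵` (cell rh-explicit, cc-s2-3).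
Honest framing: theorems about the TREE's object `weilSemilocalThreshold`; no statement about `ζ`, no RH claim.
-/

set_option linter.dupNamespace false  -- the mandated namespace repeats `RiemannHypothesis`

noncomputable section

open Set Real
open Literature.NumberTheory.LFunctions
open Summit.RiemannHypothesis.RiemannHypothesis.Theorems.MotivicDoor.SemilocalThreshold
open Summit.RiemannHypothesis.RiemannHypothesis.Theorems.MotivicDoor.Semilocal
open Summit.RiemannHypothesis.RiemannHypothesis.Theorems.SemilocalCertificateBridge

namespace Summit.RiemannHypothesis.RiemannHypothesis.Theorems.SemilocalCert554

/-- The window of `weilCert3S554` is `277/500`. [folklore] -/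
theorem certb_cert554 : weilCert3S554.b = 277 / 500 := rfl

/-- The window passes the decidable `log 2` test of the bridge: `277/500 ≤ 6931471/10⁷`. [folklore] -/
theorem certb_cert554_le : weilCert3S554.b ≤ 6931471 / 10000000 := by
  rw [certb_cert554]; norm_num

/-- **`{∞,2}`-positivity on `C(277/500)`**: the semi-local Weil form of `S = {2}` is non-negative on every test
function supported in `[-0.554, 0.554]` (kernel-checked Stage-C certificate + bridge (B+)). [folklore] -/
theorem weilSemilocalPositivityOn_two_554 : WeilSemilocalPositivityOn {2} ((277 : ℝ) / 500) := by
  have h := weilSemilocalPositivityOn_two_of_check_of_le check_cert554 certb_cert554_le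
  rw [certb_cert554] at h
  convert h using 2
  push_cast
  ring

/-- **Lower rung of CC-M2: `277/500 = 0.554 ≤ a*({2})`.** [folklore] -/
theorem le_weilSemilocalThreshold_two_554 : (277 : ℝ) / 500 ≤ weilSemilocalThreshold {2} :=
  le_weilSemilocalThreshold weilSemilocalPositivityOn_two_554

/-- The two-sided location with the tree's upper rung `97/174`: `a*({2}) ∈ [277/500, 97/174] = [0.554, 0.557471…]`. [folklore] -/
theorem weilSemilocalThreshold_two_mem_Icc_554_055747 :
    weilSemilocalThreshold {2} ∈ Icc ((277 : ℝ) / 500) (97 / 174) := by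
  refine ⟨le_weilSemilocalThreshold_two_554, ?_⟩
  have h := Summit.RiemannHypothesis.RiemannHypothesis.Theorems.SemilocalPolyWitness.weilSemilocalThreshold_two_le_055747
  exact h.trans (by push_cast; norm_num)

/-- Transport to every finite set of places `S ∋ 2` with `3 ∉ S`: `0.554 ≤ a*(S)`. [folklore] -/
theorem le_weilSemilocalThreshold_554 {S : Finset ℕ} (h2 : 2 ∈ S) (h3 : 3 ∉ S) :
    (277 : ℝ) / 500 ≤ weilSemilocalThreshold S := by
  rw [weilSemilocalThreshold_eq_two h2 h3]
  exact le_weilSemilocalThreshold_two_554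

end Summit.RiemannHypothesis.RiemannHypothesis.Theorems.SemilocalCert554

end
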